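import Summits.AtomisticToContinuum.Crystallization.Theorems.UniformBindingRigidity.Negative.MinimaxFloor

/-!
# Negative knowledge for crux `PerronTransitivity.UniformBindingRigidity` (stmt-AtomisticToContinuum-15099), V:
# zero slack for ARBITRARY members of the hypothesis class — super-bound sites have density zero

Refuter vetting (crux disprover, `--supports stmt-AtomisticToContinuum-15099`).  Part II
(`PeriodicCeiling`) proved that a PERIODIC configuration all of whose sites are bound `≤ 2E*` has every
site bound at EXACTLY `2E*`; part III (`MinimaxFloor`) proved that NO uniformly discrete set has all sites
`≤ 2E* − ε`.  Here the two are interpolated for an arbitrary member `X` of the hypothesis class `H` of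
M* (non-empty, uniformly discrete, every site `≤ 2E*`):

* `sum_defect_le` — the total DEFECT `Σ_{a ∈ X ∩ B̄(0,R)} (2E* − U_X(a))` of a ball is paid for by its
  boundary: `≤ N(R)·(1/6)·1024/((1/4)³T³) + (N(R) − N(R−T))·(1/6)·1024·4⁶` for every `T ≥ 1/4`
  (`N(R) = #(X ∩ B̄(0,R))`);
* `sparse_superbound` — **super-bound sites are sparse**: for every `η > 0`, `ε > 0` and `R₀` there is a
  radius `R ≥ R₀` at which the sites of `X ∩ B̄(0,R)` bound `≤ 2E* − η` number at most `ε·N(R)`.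
  (Otherwise the defect would force geometric inward decay `N(R−T) ≤ θN(R)` as in part III, against the
  cubic packing bound.)

So a member of `H` is bound at EXACTLY the crystal average at all but a lower-density-zero set of sites
(along suitable radii): the hypothesis class of M* is, up to sparse defects, the class of exactly
energy-transitive configurations `U_X ≡ 2E*` of the sibling crux `TransitiveLocalLimit`; and M* cannot be
refuted by any configuration carrying a positive density of strictly super-bound sites — none exists.
All `[folklore]`.
-/

noncomputable section

namespace Summit.AtomisticToContinuum.Crystallization.Theorems.UniformBindingRigidity.Negative.SparseSuperBinding

open scoped BigOperators Topology
open Filter Set Metric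
open Literature.MathematicalPhysics.StatisticalMechanics
open Summit.AtomisticToContinuum.Crystallization.Theorems.ChargedEnergyGapNegative (E3 eStar eStar_le)
open Summit.AtomisticToContinuum.Crystallization.Theorems.PerronTransitivityUniformBindingRigidity
  (quarter_le_dist two_mul_iInf_lt_zero finite_sep_ball)
open Summit.AtomisticToContinuum.Crystallization.Theorems.HullBulkOptimal (ncard_ball_le)
open Summit.AtomisticToContinuum.Crystallization.Theorems.UniformBindingRigidity.Negative.MinimaxFloor
  (card_mul_le_sum_sum sum_erase_le_tsum_add_max)

/-! ## §1 The defect of a ball is paid for by its boundary -/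

/-- **Defect bound.** For a `1/4`-separated `X` and the clusters `F = X ∩ B̄(0,R) ⊇ F' = X ∩ B̄(0,R−T)`
(`T ≥ 1/4`): `Σ_{a ∈ F} (2E* − U_X(a)) ≤ |F|·(1/6)·1024/((1/4)³T³) + (|F| − |F'|)·(1/6)·1024·4⁶`.
[folklore] -/
theorem sum_defect_le {X : Set E3}
    (hsep : ∀ p ∈ X, ∀ q ∈ X, p ≠ q → 1 / 4 ≤ dist p q)
    {R T : ℝ} (hT : 1 / 4 ≤ T) (F F' : Finset E3)
    (hF : ∀ a, a ∈ F ↔ a ∈ X ∧ dist a 0 ≤ R) (hF' : ∀ a, a ∈ F' ↔ a ∈ X ∧ dist a 0 ≤ R - T) :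
    ∑ a ∈ F, (2 * eStar - ∑' q : {q : E3 // q ∈ X ∧ q ≠ a}, lennardJones (dist a q.1)) ≤
      F.card * (1 / 6 * (1024 / ((1 / 4 : ℝ) ^ 3 * T ^ 3))) +
        (F.card - F'.card) * (1 / 6 * (1024 / ((1 / 4 : ℝ) ^ 3 * (1 / 4 : ℝ) ^ 3))) := by
  classical
  have hT0 : 0 < T := lt_of_lt_of_le (by norm_num) hT
  have hsub : F' ⊆ F := fun a ha => by
    rw [hF'] at ha
    rw [hF]
    exact ⟨ha.1, by linarith [ha.2]⟩
  set τ : E3 → ℝ := fun a =>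
    1 / 6 * (1024 / ((1 / 4 : ℝ) ^ 3 * (max (R - dist a 0) (1 / 4)) ^ 3)) with hτ
  set τT : ℝ := 1 / 6 * (1024 / ((1 / 4 : ℝ) ^ 3 * T ^ 3)) with hτT
  set W : ℝ := 1 / 6 * (1024 / ((1 / 4 : ℝ) ^ 3 * (1 / 4 : ℝ) ^ 3)) with hW
  have h1 := card_mul_le_sum_sum F
  have h2 : ∑ a ∈ F, ∑ b ∈ F.erase a, lennardJones (dist a b) ≤
      ∑ a ∈ F, ((∑' q : {q : E3 // q ∈ X ∧ q ≠ a}, lennardJones (dist a q.1)) + τ a) :=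
    Finset.sum_le_sum fun a ha => sum_erase_le_tsum_add_max hsep F hF ha
  have h3 : ∑ a ∈ F, (2 * eStar - ∑' q : {q : E3 // q ∈ X ∧ q ≠ a}, lennardJones (dist a q.1)) =
      F.card * (2 * eStar) - ∑ a ∈ F, ∑' q : {q : E3 // q ∈ X ∧ q ≠ a}, lennardJones (dist a q.1) := by
    rw [Finset.sum_sub_distrib, Finset.sum_const, nsmul_eq_mul]
  have h4 : ∑ a ∈ F, ((∑' q : {q : E3 // q ∈ X ∧ q ≠ a}, lennardJones (dist a q.1)) + τ a) =
      (∑ a ∈ F, ∑' q : {q : E3 // q ∈ X ∧ q ≠ a}, lennardJones (dist a q.1)) + ∑ a ∈ F, τ a :=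
    Finset.sum_add_distrib
  have h5 : ∑ a ∈ F, τ a = ∑ a ∈ F \ F', τ a + ∑ a ∈ F', τ a := (Finset.sum_sdiff hsub).symm
  have hτT_le : ∀ a ∈ F', τ a ≤ τT := by
    intro a ha
    rw [hF'] at ha
    have hmax : T ≤ max (R - dist a 0) (1 / 4) := le_max_of_le_left (by linarith [ha.2])
    simp only [hτ, hτT]
    gcongr
  have hτW_le : ∀ a ∈ F \ F', τ a ≤ W := by
    intro a _
    have hmax : (1 / 4 : ℝ) ≤ max (R - dist a 0) (1 / 4) := le_max_right _ _
    simp only [hτ, hW]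
    gcongr
  have h6 : ∑ a ∈ F', τ a ≤ F'.card * τT := by
    have := Finset.sum_le_sum hτT_le
    rwa [Finset.sum_const, nsmul_eq_mul] at this
  have h7 : ∑ a ∈ F \ F', τ a ≤ (F.card - F'.card) * W := by
    have := Finset.sum_le_sum hτW_le
    rw [Finset.sum_const, nsmul_eq_mul, Finset.card_sdiff_of_subset hsub,
      Nat.cast_sub (Finset.card_le_card hsub)] at this
    exact this
  have hcard : (F'.card : ℝ) ≤ F.card := by exact_mod_cast Finset.card_le_card hsub
  have hτT0 : 0 ≤ τT := by positivity
  have h8 : (F'.card : ℝ) * τT ≤ F.card * τT := mul_le_mul_of_nonneg_right hcard hτT0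
  linarith

/-! ## §2 Geometric inward decay is impossible for a non-empty separated set -/

/-- **Growth versus packing.** A counting function `n` of a `1/4`-separated set about `0`
(`n R ≤ (8R+1)³`, `n R₁ ≥ 1`) cannot decay geometrically inwards, `n (R − T) ≤ θ · n R` for all
`R ≥ R₁` with `0 ≤ θ < 1`, `T ≥ 1`. [folklore] -/
theorem not_geometric_decay {n : ℝ → ℕ} {R₁ T θ : ℝ} (hR₁ : 0 ≤ R₁) (hT1 : 1 ≤ T)
    (hθ0 : 0 ≤ θ) (hθ1 : θ < 1) (hn1 : (1 : ℝ) ≤ n R₁)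
    (hpack : ∀ R : ℝ, 0 ≤ R → (n R : ℝ) ≤ (8 * R + 1) ^ 3)
    (hstep : ∀ R : ℝ, R₁ ≤ R → (n (R - T) : ℝ) ≤ θ * n R) : False := by
  -- iterate: `n R₁ ≤ θ^k · n (R₁ + k T)`
  have hiter : ∀ k : ℕ, (n R₁ : ℝ) ≤ θ ^ k * n (R₁ + k * T) := by
    intro k
    induction k with
    | zero => simp
    | succ k ih =>
      have h2 := hstep (R₁ + (k + 1 : ℕ) * T) (by
        have : (0 : ℝ) ≤ ((k + 1 : ℕ) : ℝ) * T := by positivity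
        linarith)
      rw [show R₁ + ((k + 1 : ℕ) : ℝ) * T - T = R₁ + (k : ℝ) * T by push_cast; ring] at h2
      calc (n R₁ : ℝ) ≤ θ ^ k * n (R₁ + k * T) := ih
        _ ≤ θ ^ k * (θ * n (R₁ + ((k + 1 : ℕ) : ℝ) * T)) :=
            mul_le_mul_of_nonneg_left h2 (pow_nonneg hθ0 k)
        _ = θ ^ (k + 1) * n (R₁ + ((k + 1 : ℕ) : ℝ) * T) := by ring
  set A : ℝ := 8 * R₁ + 1 + 8 * T with hA
  have hbound : ∀ k : ℕ, (1 : ℝ) ≤ A ^ 3 * (((k + 1 : ℕ) : ℝ) ^ 3 * θ ^ k) := by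
    intro k
    have h1 := hiter k
    have h2 := hpack (R₁ + k * T) (by positivity)
    have h3 : (8 * (R₁ + k * T) + 1 : ℝ) ≤ A * ((k + 1 : ℕ) : ℝ) := by
      rw [hA]; push_cast
      nlinarith [hR₁, hT1, (Nat.cast_nonneg k : (0 : ℝ) ≤ k)]
    have h4 : (8 * (R₁ + k * T) + 1 : ℝ) ^ 3 ≤ (A * ((k + 1 : ℕ) : ℝ)) ^ 3 :=
      pow_le_pow_left₀ (by positivity) h3 3
    calc (1 : ℝ) ≤ n R₁ := hn1
      _ ≤ θ ^ k * n (R₁ + k * T) := h1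
      _ ≤ θ ^ k * (A * ((k + 1 : ℕ) : ℝ)) ^ 3 :=
          mul_le_mul_of_nonneg_left (h2.trans h4) (pow_nonneg hθ0 k)
      _ = A ^ 3 * (((k + 1 : ℕ) : ℝ) ^ 3 * θ ^ k) := by ring
  have hlim : Tendsto (fun k : ℕ => A ^ 3 * (((k + 1 : ℕ) : ℝ) ^ 3 * θ ^ k)) atTop (𝓝 0) := by
    have habs : |θ| < 1 := by rw [abs_lt]; constructor <;> linarith
    have h1 : Tendsto (fun k : ℕ => ((k : ℕ) : ℝ) ^ 3 * θ ^ k) atTop (𝓝 0) :=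
      tendsto_pow_const_mul_const_pow_of_abs_lt_one 3 habs
    have h2 : Tendsto (fun k : ℕ => (((k + 1 : ℕ) : ℝ)) ^ 3 * θ ^ (k + 1)) atTop (𝓝 0) :=
      h1.comp (tendsto_add_atTop_nat 1)
    rcases eq_or_lt_of_le hθ0 with hθz | hθpos
    · refine tendsto_const_nhds.congr' ?_
      filter_upwards [Filter.eventually_ge_atTop 1] with k hk
      rw [← hθz, zero_pow (by omega)]
      simp
    · have h3 : Tendsto (fun k : ℕ => θ⁻¹ * ((((k + 1 : ℕ) : ℝ)) ^ 3 * θ ^ (k + 1))) atTop (𝓝 0) := by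
        simpa using h2.const_mul θ⁻¹
      have h4 : (fun k : ℕ => A ^ 3 * (((k + 1 : ℕ) : ℝ) ^ 3 * θ ^ k)) =
          fun k : ℕ => A ^ 3 * (θ⁻¹ * ((((k + 1 : ℕ) : ℝ)) ^ 3 * θ ^ (k + 1))) := by
        funext k
        rw [pow_succ]
        field_simp
        ring
      rw [h4]
      simpa using h3.const_mul (A ^ 3)
  obtain ⟨k, hk⟩ := (Metric.tendsto_atTop.1 hlim (1 / 2) (by norm_num))
  have hk' := hk k le_rfl
  rw [Real.dist_eq, sub_zero, abs_lt] at hk'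
  linarith [hbound k, hk'.2]

/-! ## §3 Super-bound sites are sparse -/

/-- **Sparse super-binding.** Let `X ⊆ ℝ³` be non-empty, uniformly discrete and uniformly `2E*`-bound
(the hypothesis class of M*).  For every `η > 0`, `ε > 0` and `R₀` there is a radius `R ≥ R₀` at which the
sites of `X ∩ B̄(0,R)` bound `≤ 2E* − η` number at most `ε · #(X ∩ B̄(0,R))`. [folklore] -/
theorem sparse_superbound (X : Set (EuclideanSpace ℝ (Fin 3))) (hne : X.Nonempty)
    (hud : ∃ δ : ℝ, 0 < δ ∧ ∀ p ∈ X, ∀ q ∈ X, p ≠ q → δ ≤ dist p q)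
    (hB : ∀ p ∈ X, ∑' q : {q : EuclideanSpace ℝ (Fin 3) // q ∈ X ∧ q ≠ p}, lennardJones (dist p q.1) ≤
      2 * ⨅ Q : PeriodicConfiguration 3, Q.energyPerParticle lennardJones)
    {η : ℝ} (hη : 0 < η) {ε : ℝ} (hε : 0 < ε) (R₀ : ℝ) :
    ∃ R : ℝ, R₀ ≤ R ∧ ∀ (F S : Finset (EuclideanSpace ℝ (Fin 3))),
      (∀ a, a ∈ F ↔ a ∈ X ∧ dist a 0 ≤ R) →
      (∀ a, a ∈ S ↔ (a ∈ X ∧ dist a 0 ≤ R) ∧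
        ∑' q : {q : EuclideanSpace ℝ (Fin 3) // q ∈ X ∧ q ≠ a}, lennardJones (dist a q.1) ≤
          2 * (⨅ Q : PeriodicConfiguration 3, Q.energyPerParticle lennardJones) - η) →
      (S.card : ℝ) ≤ ε * F.card := by
  classical
  -- abbreviations
  change ∀ p ∈ X, _ ≤ 2 * eStar at hB
  show ∃ R : ℝ, R₀ ≤ R ∧ ∀ (F S : Finset E3), (∀ a, a ∈ F ↔ a ∈ X ∧ dist a 0 ≤ R) →
      (∀ a, a ∈ S ↔ (a ∈ X ∧ dist a 0 ≤ R) ∧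
        ∑' q : {q : E3 // q ∈ X ∧ q ≠ a}, lennardJones (dist a q.1) ≤ 2 * eStar - η) →
      (S.card : ℝ) ≤ ε * F.card
  -- WLOG `ε ≤ 1` and `η ε ≤ W`
  set W : ℝ := 1 / 6 * (1024 / ((1 / 4 : ℝ) ^ 3 * (1 / 4 : ℝ) ^ 3)) with hW
  have hW0 : 0 < W := by positivity
  set ε' : ℝ := min ε (W / η) with hε'
  have hε'0 : 0 < ε' := lt_min hε (div_pos hW0 hη)
  have hε'ε : ε' ≤ ε := min_le_left _ _
  have hηε : η * ε' ≤ W := by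
    have : ε' ≤ W / η := min_le_right _ _
    rwa [le_div_iff₀' hη] at this
  -- separation, finiteness of balls, packing
  have h20 : 2 * eStar < 0 := two_mul_iInf_lt_zero
  have hsep : ∀ p ∈ X, ∀ q ∈ X, p ≠ q → 1 / 4 ≤ dist p q :=
    quarter_le_dist hud fun p hp => (hB p hp).trans h20.le
  have h4 : (0 : ℝ) < 1 / 4 := by norm_num
  have hfin : ∀ R : ℝ, ({q : E3 | q ∈ X ∧ dist q 0 ≤ R} : Set E3).Finite :=
    fun R => finite_sep_ball h4 hsep 0 R
  have hmem : ∀ (R : ℝ) (a : E3), a ∈ (hfin R).toFinset ↔ a ∈ X ∧ dist a 0 ≤ R :=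
    fun R a => by rw [Set.Finite.mem_toFinset]; rfl
  set n : ℝ → ℕ := fun R => (hfin R).toFinset.card with hn
  have hpack : ∀ R : ℝ, 0 ≤ R → (n R : ℝ) ≤ (8 * R + 1) ^ 3 := by
    intro R hR
    have h := ncard_ball_le h4 hsep (0 : E3) hR
    rw [Set.ncard_eq_toFinset_card _ (hfin R)] at h
    rw [show (2 * R / (1 / 4) + 1 : ℝ) = 8 * R + 1 by ring] at h
    exact h
  -- suppose the claim fails beyond `R₀` (for the smaller fraction `ε'`)
  by_contra hcon
  push Not at hcon
  -- then at every `R ≥ R₀` the super-bound sites are many: `ε' n R < #S_R`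
  have hmany : ∀ R : ℝ, R₀ ≤ R → ε' * n R <
      (((hfin R).toFinset.filter fun a =>
        ∑' q : {q : E3 // q ∈ X ∧ q ≠ a}, lennardJones (dist a q.1) ≤ 2 * eStar - η).card : ℝ) := by
    intro R hR
    obtain ⟨F, S, hF, hS, hlt⟩ := hcon R hR
    have hFeq : F = (hfin R).toFinset := by
      ext a; rw [hF, hmem]
    have hSeq : S = (hfin R).toFinset.filter fun a =>
        ∑' q : {q : E3 // q ∈ X ∧ q ≠ a}, lennardJones (dist a q.1) ≤ 2 * eStar - η := by
      ext a; rw [hS, Finset.mem_filter, hmem]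
    rw [hFeq] at hlt; rw [hSeq] at hlt
    have : ε' * (n R : ℝ) ≤ ε * n R := mul_le_mul_of_nonneg_right hε'ε (Nat.cast_nonneg _)
    simp only [hn] at this ⊢
    linarith
  -- the defect of the ball `B̄(0,R)` is at least `η · #S_R > η ε' n R`
  have hdef : ∀ R : ℝ, R₀ ≤ R → η * ε' * n R <
      ∑ a ∈ (hfin R).toFinset, (2 * eStar - ∑' q : {q : E3 // q ∈ X ∧ q ≠ a}, lennardJones (dist a q.1)) := by
    intro R hR
    set F := (hfin R).toFinset
    set S := F.filter fun a =>
        ∑' q : {q : E3 // q ∈ X ∧ q ≠ a}, lennardJones (dist a q.1) ≤ 2 * eStar - η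
    have hSF : S ⊆ F := Finset.filter_subset _ _
    have h1 : η * S.card ≤ ∑ a ∈ S, (2 * eStar - ∑' q : {q : E3 // q ∈ X ∧ q ≠ a}, lennardJones (dist a q.1)) := by
      have : ∀ a ∈ S, η ≤ 2 * eStar - ∑' q : {q : E3 // q ∈ X ∧ q ≠ a}, lennardJones (dist a q.1) := by
        intro a ha
        have := (Finset.mem_filter.1 ha).2
        linarith
      have h := Finset.sum_le_sum this
      rw [Finset.sum_const, nsmul_eq_mul, mul_comm] at h
      exact h
    have h2 : ∑ a ∈ S, (2 * eStar - ∑' q : {q : E3 // q ∈ X ∧ q ≠ a}, lennardJones (dist a q.1)) ≤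
        ∑ a ∈ F, (2 * eStar - ∑' q : {q : E3 // q ∈ X ∧ q ≠ a}, lennardJones (dist a q.1)) := by
      refine Finset.sum_le_sum_of_subset_of_nonneg hSF fun a ha _ => ?_
      have := hB a ((hmem R a).1 ha).1
      linarith
    have h3 := hmany R hR
    have h4 : η * (ε' * n R) < η * S.card := mul_lt_mul_of_pos_left h3 hη
    linarith
  -- depth `T` with far tail `≤ ηε'/2`
  set T : ℝ := max 1 (65536 / (3 * (η * ε'))) with hT
  have hT1 : 1 ≤ T := le_max_left _ _
  have hT4 : 1 / 4 ≤ T := by linarith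
  have hηε0 : 0 < η * ε' := mul_pos hη hε'0
  have hτT : 1 / 6 * (1024 / ((1 / 4 : ℝ) ^ 3 * T ^ 3)) ≤ η * ε' / 2 := by
    have hT0 : 0 < T := by linarith
    have hTε : 65536 / (3 * (η * ε')) ≤ T := le_max_right _ _
    have hT3 : T ≤ T ^ 3 := by
      calc T = T * 1 * 1 := by ring
        _ ≤ T * T * T := by gcongr
        _ = T ^ 3 := by ring
    rw [show 1 / 6 * (1024 / ((1 / 4 : ℝ) ^ 3 * T ^ 3)) = 65536 / 6 / T ^ 3 by
      field_simp; ring]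
    rw [div_le_iff₀ (by positivity)]
    have h3ε : 65536 ≤ T * (3 * (η * ε')) := by
      rwa [div_le_iff₀ (by positivity)] at hTε
    nlinarith
  -- geometric inward decay beyond `R₀`
  set θ : ℝ := 1 - η * ε' / (2 * W) with hθ
  have hθ0 : 0 ≤ θ := by
    rw [hθ, sub_nonneg, div_le_one (by positivity)]
    linarith
  have hθ1 : θ < 1 := by
    rw [hθ]
    have : 0 < η * ε' / (2 * W) := by positivity
    linarith
  have hstep : ∀ R : ℝ, R₀ ≤ R → (n (R - T) : ℝ) ≤ θ * n R := by
    intro R hR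
    have h := sum_defect_le hsep hT4 (hfin R).toFinset (hfin (R - T)).toFinset (hmem R) (hmem (R - T))
    have hd := hdef R hR
    have hnR : (0 : ℝ) ≤ n R := Nat.cast_nonneg _
    have h' : η * ε' * (n R : ℝ) ≤ n R * (η * ε' / 2) + (n R - n (R - T)) * W := by
      have := mul_le_mul_of_nonneg_left hτT hnR
      simp only [hn] at h hd this ⊢
      linarith
    have key : (n R : ℝ) * (η * ε' / 2) / W ≤ n R - n (R - T) := by
      rw [div_le_iff₀ hW0]
      linarith
    have hθn : θ * n R = n R - (n R : ℝ) * (η * ε' / 2) / W := by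
      rw [hθ]
      field_simp
    linarith
  -- a radius `R₁ ≥ max R₀ 0` with `n R₁ ≥ 1`
  obtain ⟨p₀, hp₀⟩ := hne
  set R₁ : ℝ := max (max R₀ 0) (dist p₀ 0) with hR₁
  have hR₁0 : 0 ≤ R₁ := le_trans (le_max_right _ _) (le_max_left _ _)
  have hR₁R₀ : R₀ ≤ R₁ := le_trans (le_max_left _ _) (le_max_left _ _)
  have hn1 : (1 : ℝ) ≤ n R₁ := by
    have : p₀ ∈ (hfin R₁).toFinset := (hmem R₁ p₀).2 ⟨hp₀, le_max_right _ _⟩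
    exact_mod_cast Finset.card_pos.2 ⟨p₀, this⟩
  exact not_geometric_decay hR₁0 hT1 hθ0 hθ1 hn1 hpack fun R hR => hstep R (hR₁R₀.trans hR)

/-- **Density-zero form along radii**: for `X` in the hypothesis class of M* and every `η > 0`, the
lower density (along balls about `0`) of the sites bound `≤ 2E* − η` is zero — stated as: for every
`ε > 0` there are arbitrarily large radii at which their proportion is `≤ ε`. [folklore] -/
theorem frequently_sparse_superbound (X : Set (EuclideanSpace ℝ (Fin 3))) (hne : X.Nonempty)
    (hud : ∃ δ : ℝ, 0 < δ ∧ ∀ p ∈ X, ∀ q ∈ X, p ≠ q → δ ≤ dist p q)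
    (hB : ∀ p ∈ X, ∑' q : {q : EuclideanSpace ℝ (Fin 3) // q ∈ X ∧ q ≠ p}, lennardJones (dist p q.1) ≤
      2 * ⨅ Q : PeriodicConfiguration 3, Q.energyPerParticle lennardJones)
    {η : ℝ} (hη : 0 < η) {ε : ℝ} (hε : 0 < ε) :
    ∃ᶠ R in atTop, ∀ (F S : Finset (EuclideanSpace ℝ (Fin 3))),
      (∀ a, a ∈ F ↔ a ∈ X ∧ dist a 0 ≤ R) →
      (∀ a, a ∈ S ↔ (a ∈ X ∧ dist a 0 ≤ R) ∧
        ∑' q : {q : EuclideanSpace ℝ (Fin 3) // q ∈ X ∧ q ≠ a}, lennardJones (dist a q.1) ≤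
          2 * (⨅ Q : PeriodicConfiguration 3, Q.energyPerParticle lennardJones) - η) →
      (S.card : ℝ) ≤ ε * F.card := by
  rw [Filter.frequently_atTop]
  intro R₀
  obtain ⟨R, hR, h⟩ := sparse_superbound X hne hud hB hη hε R₀
  exact ⟨R, hR, h⟩

end Summit.AtomisticToContinuum.Crystallization.Theorems.UniformBindingRigidity.Negative.SparseSuperBinding

end
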